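/-
Copyright (c) 2026 the pub-hodgecm-mathlib formalisation cell (harness21).  Prover seat hodgecm-mathlib-A-p06 (g28) — (U) road brick (b1)∕U1 «per-place top-form
factors» (LEAD F0P3a-plan (g10) WORD T9-34 (2); (U) road owner A-p19 (g24)), 2026-09-01.
-/
import Literature.NumberTheory.Automorphic.UnitaryGroupArchimedeanPlaces     -- ★ `archLocal L N H w = unitaryGroupOfForm (starRingEnd ℂ) (H.map w.1.embedding)`
import Literature.NumberTheory.Automorphic.UnitaryFormGroupUnimodular         -- ★ `locallyCompactSpace_unitaryGroupOfForm_complex`, `isClosed_…`, `secondCountableTopology_…`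
import Literature.Analysis.Calculus.CayleyTransform                           -- ★ generic `cayley X = (1 − X)(1 + X)⁻¹`
import Mathlib.MeasureTheory.Measure.Haar.OfBasis
import Mathlib.MeasureTheory.Measure.Lebesgue.EqHaar
import Mathlib.Analysis.Matrix.Normed
import HarnessLib

/-!
# The Cayley chart of ONE archimedean factor `U(Jw)(ℂ) ≤ GL_N(ℂ)`: the real form `𝔲(Jw) ⊂ M_N(ℂ)`, the key equivalence, `ĉ : 𝔲(Jw) → U(Jw)(ℂ)` and its inverse
# ((U) road, brick U1 = CENSUS-Jval (b1), FILE A; Weyl 1939 Ch. II §10; Knapp 2002 I §1)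

Topic `NumberTheory/Weil1964` (the D-T road's measure bricks), namespace `Literature.NumberTheory.Weil1964.UnitaryArchLocalTopForm`.  FILE A of brick U1: DEFINITIONS WITH
BODIES (`skewC`, `cayleySourceC`, `cayleyChartC`, `cayleyInvC`) and proved theorems; no named fact (net debt 0), no instance, no notation, no `sorry`.  FILE B
(`UnitaryArchLocalTopFormHaar`) puts the trace-form Lebesgue measure and the top-form Haar measure on top of this chart.  Cell `pub/hodgecm-mathlib`, crux H413 = `stmt-HodgeConjecture-24833` (supports only); (U) road (LEAD T9-32 (4), T9-34 (2); owner A-p19 (g24); source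
census `F0/P3/F0P3-p03/g10/CENSUS-Jval-ArchCovolumeRatio.F0P3p03g10.md` §1 (b1); my census `F0/P3a/A-p06/g28/CENSUS-U-b1-ArchLocalTopFormHaar.A-p06g28.md`, design B′).
HONEST LABEL: HC_CM is proved only modulo the 2 remaining named inputs (hLiu418 24832, h413 24833) until rung 0 closes; this file NAMES a measure and proves it is a
Haar measure — it discharges no printed statement.

THE DESIGN — THE ★ GLOBAL CHAIN OF THE D-T ROAD, READ AT ONE COMPLEX PLACE.  The tree's ★ `Weil1964/UnitaryArchTopFormHaar` builds, on the GLOBAL archimedean group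
`U(J)(E ⊗ ℝ) = arch F E c N J ≤ GL_N(E ⊗ ℝ)`, the Haar measure `archTopFormHaar J = (ν(W) ∕ haar(W)) • Measure.haar` whose germ in the Cayley chart `ĉ(X) = (1 − X)(1 + X)⁻¹`
(★ B5a `UnitaryGroupArchCayleyChart`) is the trace-form Lebesgue measure `|ω_std|` on `𝔲(J)` times the Jacobian weight `w₀ = |det m_Y|𝔲|⁻¹` (★ `…CayleyJacobian`, ★ B5b
`…CayleyHaar`).  THIS FILE repeats the STATIC part of that construction for ONE factor: for any `Jw ∈ M_N(ℂ)` (read `Jw := H.map w.1.embedding` at a complex place `w` of the CM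
field `L`, so that the group is ★ `archLocal L N H w = unitaryGroupOfForm (starRingEnd ℂ) Jw`, definitionally):
* §1 the real form `𝔲(Jw) = skewC N Jw = {X ∈ M_N(ℂ) | Xᴴ Jw + Jw X = 0}`, the key equivalence `(ĉ X)ᴴ Jw (ĉ X) = Jw ↔ X ∈ 𝔲(Jw)` (for `1 + X` invertible) and the
  Cayley chart `cayleyChartC : 𝔲(Jw) → U(Jw)(ℂ)` on `cayleySourceC = {1 ± X invertible}` (junk `1` off it) — the ★ `UnitaryGroupArchSkew`∕B5a algebra with `(σX)ᵀ ↦ Xᴴ`;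
* (FILE B) the trace form `Re tr(XY)`, the basis-free Lebesgue measure on `𝔲(Jw)`, the weight `|det m_Y|⁻¹`, the window, the chart measure and
  **`localTopFormHaar N Jw := (ν(W) ∕ haar(ĉ '' W)) • Measure.haar`**, **`archLocalTopFormHaar L N H w := localTopFormHaar N (H.map w.1.embedding)`**.
WHAT IS NOT HERE (by design B′, owner's note 12:24:32Z «do NOT re-run ★ B5b locally»): the per-place Jacobian cocycle ∕ local left-invariance of the chart measure and the
per-place window identity `μ|_{ĉ(V₀)} = ĉ_*(w₀·λ|_{V₀})`; they follow from the PRODUCT THEOREM (U2, file `UnitaryArchTopFormHaarProductPlaces`: `(archPiEquivCM)_* archTopFormHaar =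
Measure.pi archLocalTopFormHaar`, proved from the ★ GLOBAL window identity and three factorisations) by slicing.  Non-degeneracy of `β` on `𝔲(Jw)` (`lieGramDetC ≠ 0`) is a
hypothesis of `isHaarMeasure_…` exactly as in the global file (it holds for `Jw` hermitian non-degenerate: ★ `traceForm_skewAdjoint_pos` read at one place; U2's business).

## References
* J. D. Rogawski, *Automorphic Representations of Unitary Groups in Three Variables*, Ann. of Math. Stud. 123 (1990), §1.7 p. 6. [Rogawski1990]
* S. Helgason, *Groups and Geometric Analysis*, AMS Math. Surveys Monogr. 83 (2000), Ch. I §1 Thm. 1.14 p. 96. [Helgason2000]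
* I. G. Macdonald, *The volume of a compact Lie group*, Invent. Math. 56 (1980), 93–95. [Macdonald1980]
* H. Weyl, *The Classical Groups* (1939), Ch. II §10. [Weyl1939]
* A. W. Knapp, *Lie Groups Beyond an Introduction*, 2nd ed. (2002), I §1, VIII §2. [Knapp2002]
-/

set_option autoImplicit false

noncomputable section

open Set Filter Topology MeasureTheory MeasureTheory.Measure Literature.Analysis.Calculus
open scoped Classical Matrix Matrix.Norms.Operator MatrixGroups ENNReal NNReal Pointwise

namespace Literature.NumberTheory.Weil1964

namespace UnitaryArchLocalTopForm

open Literature.NumberTheory.Automorphic Literature.NumberTheory.Automorphic.UnitaryGroup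

/-! ## §1 The real form `𝔲(Jw) ⊂ M_N(ℂ)`, the key equivalence, the Cayley chart -/

section Skew

variable (N : ℕ) (Jw : Matrix (Fin N) (Fin N) ℂ)

/-- **`𝔲(Jw) = {X ∈ M_N(ℂ) | Xᴴ Jw + Jw X = 0}`**, the `Jw`-skew-hermitian matrices as a REAL subspace of `M_N(ℂ)` (the Lie algebra of `U(Jw)(ℂ)`; the one-place reading of ★
`archSkew`). [cite: Knapp2002, I §1] [cite: Weyl1939, Ch. II §10] -/
def skewC : Submodule ℝ (Matrix (Fin N) (Fin N) ℂ) where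
  carrier := {X | Xᴴ * Jw + Jw * X = 0}
  zero_mem' := by simp
  add_mem' {X Y} hX hY := by
    simp only [Set.mem_setOf_eq] at hX hY ⊢
    rw [Matrix.conjTranspose_add, add_mul, mul_add, add_add_add_comm, hX, hY, add_zero]
  smul_mem' t X hX := by
    simp only [Set.mem_setOf_eq] at hX ⊢
    rw [Matrix.conjTranspose_smul, star_trivial, smul_mul_assoc, mul_smul_comm, ← smul_add, hX, smul_zero]

variable {N Jw}

/-- Membership in `𝔲(Jw)`. [cite: Knapp2002, I §1] -/
theorem mem_skewC_iff (X : Matrix (Fin N) (Fin N) ℂ) : X ∈ skewC N Jw ↔ Xᴴ * Jw + Jw * X = 0 := Iff.rfl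

/-- `𝔲(Jw)` is closed. [cite: Knapp2002, I §1] -/
theorem isClosed_skewC : IsClosed (skewC N Jw : Set (Matrix (Fin N) (Fin N) ℂ)) := by
  have hc : Continuous fun X : Matrix (Fin N) (Fin N) ℂ => Xᴴ := (continuous_id.matrix_map continuous_star).matrix_transpose
  exact isClosed_eq ((hc.mul continuous_const).add (continuous_const.mul continuous_id)) continuous_const

/-- `(1 + X)ᴴ = 1 + Xᴴ`. [cite: Knapp2002, I §1] -/
theorem conjTranspose_one_add (X : Matrix (Fin N) (Fin N) ℂ) : (1 + X)ᴴ = 1 + Xᴴ := by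
  rw [Matrix.conjTranspose_add, Matrix.conjTranspose_one]

/-- `(1 − X)ᴴ = 1 − Xᴴ`. [cite: Knapp2002, I §1] -/
theorem conjTranspose_one_sub (X : Matrix (Fin N) (Fin N) ℂ) : (1 - X)ᴴ = 1 - Xᴴ := by
  rw [Matrix.conjTranspose_sub, Matrix.conjTranspose_one]

/-- `ᴴ` preserves invertibility. [cite: Weyl1939, Ch. II §10] -/
theorem isUnit_conjTranspose {A : Matrix (Fin N) (Fin N) ℂ} (h : IsUnit A) : IsUnit Aᴴ := by
  obtain ⟨u, hu⟩ := h
  exact ⟨⟨(u : Matrix (Fin N) (Fin N) ℂ)ᴴ, ((u⁻¹ : (Matrix (Fin N) (Fin N) ℂ)ˣ) : Matrix (Fin N) (Fin N) ℂ)ᴴ,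
    by rw [← Matrix.conjTranspose_mul, Units.inv_mul, Matrix.conjTranspose_one],
    by rw [← Matrix.conjTranspose_mul, Units.mul_inv, Matrix.conjTranspose_one]⟩, by rw [← hu]⟩

/-- `Ring.inverse` on matrices is the non-singular inverse, which commutes with `ᴴ`. [cite: Weyl1939, Ch. II §10] -/
theorem conjTranspose_ringInverse (A : Matrix (Fin N) (Fin N) ℂ) : (Ring.inverse A)ᴴ = Ring.inverse Aᴴ := by
  rw [← Matrix.nonsing_inv_eq_ringInverse, ← Matrix.nonsing_inv_eq_ringInverse, Matrix.conjTranspose_nonsing_inv]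

/-- **`ᴴ` commutes with the Cayley transform**: `(ĉ X)ᴴ = ĉ (Xᴴ)` for `1 + X` invertible. [cite: Weyl1939, Ch. II §10] -/
theorem conjTranspose_cayley {X : Matrix (Fin N) (Fin N) ℂ} (h : IsUnit (1 + X)) : (cayley X)ᴴ = cayley Xᴴ := by
  have h' : IsUnit (1 + Xᴴ) := by rw [← conjTranspose_one_add]; exact isUnit_conjTranspose h
  rw [cayley_def, Matrix.conjTranspose_mul, conjTranspose_ringInverse, conjTranspose_one_add, conjTranspose_one_sub, cayley_eq_inverse_mul h']

/-- **THE KEY EQUIVALENCE at one place.**  For `1 + X` invertible, `(ĉ X)ᴴ · Jw · ĉ X = Jw ↔ Xᴴ Jw + Jw X = 0` (`(1 − Xᴴ) Jw (1 − X) = (1 + Xᴴ) Jw (1 + X) ⟺ 2 (Xᴴ Jw + Jw X) = 0`;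
no hypothesis on `Jw` — ★ `archStar_cayley_mul_mul_cayley_eq_iff` with `(σX)ᵀ ↦ Xᴴ`). [cite: Weyl1939, Ch. II §10] -/
theorem conjTranspose_cayley_mul_mul_cayley_eq_iff {X : Matrix (Fin N) (Fin N) ℂ} (h : IsUnit (1 + X)) :
    (cayley X)ᴴ * Jw * cayley X = Jw ↔ X ∈ skewC N Jw := by
  have h' : IsUnit (1 + Xᴴ) := by rw [← conjTranspose_one_add]; exact isUnit_conjTranspose h
  obtain ⟨u, hu⟩ := id h
  obtain ⟨v, hv⟩ := id h'
  have hiu : Ring.inverse (1 + X) = ((u⁻¹ : (Matrix (Fin N) (Fin N) ℂ)ˣ) : Matrix (Fin N) (Fin N) ℂ) := by rw [← hu, Ring.inverse_unit]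
  have hiv : Ring.inverse (1 + Xᴴ) = ((v⁻¹ : (Matrix (Fin N) (Fin N) ℂ)ˣ) : Matrix (Fin N) (Fin N) ℂ) := by rw [← hv, Ring.inverse_unit]
  rw [mem_skewC_iff]
  -- `(ĉ X)ᴴ Jw (ĉ X) = (1+Xᴴ)⁻¹ ((1 − Xᴴ) Jw (1 − X)) (1+X)⁻¹`
  have e1 : (cayley X)ᴴ * Jw * cayley X =
      ((v⁻¹ : (Matrix (Fin N) (Fin N) ℂ)ˣ) : Matrix (Fin N) (Fin N) ℂ) * ((1 - Xᴴ) * Jw * (1 - X)) *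
        ((u⁻¹ : (Matrix (Fin N) (Fin N) ℂ)ˣ) : Matrix (Fin N) (Fin N) ℂ) := by
    rw [conjTranspose_cayley h, cayley_eq_inverse_mul h', cayley_def, hiu, hiv]
    simp only [mul_assoc]
  -- `(1 + Xᴴ) Jw (1 + X) − (1 − Xᴴ) Jw (1 − X) = 2 (Xᴴ Jw + Jw X)`
  have e4 : (v : Matrix (Fin N) (Fin N) ℂ) * Jw * (u : Matrix (Fin N) (Fin N) ℂ) - (1 - Xᴴ) * Jw * (1 - X) = 2 * (Xᴴ * Jw + Jw * X) := by
    rw [hu, hv]; noncomm_ring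
  rw [e1]
  constructor
  · intro e
    have e2 : (1 - Xᴴ) * Jw * (1 - X) = (v : Matrix (Fin N) (Fin N) ℂ) * Jw * (u : Matrix (Fin N) (Fin N) ℂ) := by
      conv_rhs => rw [← e]
      simp only [mul_assoc, Units.mul_inv_cancel_left, Units.inv_mul, mul_one]
    rw [← two_mul_eq_zero_iff, ← e4, e2, sub_self]
  · intro e
    rw [e, mul_zero, sub_eq_zero] at e4
    rw [← e4]
    simp only [mul_assoc, Units.inv_mul_cancel_left, Units.mul_inv, mul_one]

/-- Membership in `U(Jw)(ℂ) = unitaryGroupOfForm (starRingEnd ℂ) Jw` in the `ᴴ` spelling (`(g.map star)ᵀ = gᴴ` definitionally). [cite: Knapp2002, I §1] -/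
theorem mem_unitaryGroupOfForm_conj_iff (g : GL (Fin N) ℂ) :
    g ∈ unitaryGroupOfForm (starRingEnd ℂ) Jw ↔ (g : Matrix (Fin N) (Fin N) ℂ)ᴴ * Jw * (g : Matrix (Fin N) (Fin N) ℂ) = Jw :=
  Iff.rfl

/-- **The Cayley transform of a `Jw`-skew-hermitian `X` with `1 ± X` invertible lies in `U(Jw)(ℂ)`.** [cite: Weyl1939, Ch. II §10] -/
theorem cayley_mem_unitaryGroupOfForm_conj {X : Matrix (Fin N) (Fin N) ℂ} (hX : X ∈ skewC N Jw) (h : IsUnit (1 + X)) (h' : IsUnit (1 - X)) :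
    (isUnit_cayley h h').unit ∈ unitaryGroupOfForm (starRingEnd ℂ) Jw := by
  rw [mem_unitaryGroupOfForm_conj_iff, IsUnit.unit_spec]
  exact (conjTranspose_cayley_mul_mul_cayley_eq_iff h).2 hX

/-- Conversely, the Cayley transform of `g ∈ U(Jw)(ℂ)` with `1 + g` invertible is `Jw`-skew-hermitian. [cite: Weyl1939, Ch. II §10] -/
theorem cayley_coe_mem_skewC {g : GL (Fin N) ℂ} (hg : g ∈ unitaryGroupOfForm (starRingEnd ℂ) Jw) (h : IsUnit (1 + (g : Matrix (Fin N) (Fin N) ℂ))) :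
    cayley (g : Matrix (Fin N) (Fin N) ℂ) ∈ skewC N Jw := by
  have h1 : IsUnit (1 + cayley (g : Matrix (Fin N) (Fin N) ℂ)) := isUnit_one_add_cayley h
  rw [← conjTranspose_cayley_mul_mul_cayley_eq_iff h1, cayley_cayley h]
  exact (mem_unitaryGroupOfForm_conj_iff g).1 hg

variable (N Jw)

/-- The source of the Cayley chart: `{X ∈ 𝔲(Jw) | 1 + X, 1 − X invertible}`. [cite: Weyl1939, Ch. II §10] -/
def cayleySourceC : Set (skewC N Jw) :=
  {X | IsUnit (1 + (X : Matrix (Fin N) (Fin N) ℂ)) ∧ IsUnit (1 - (X : Matrix (Fin N) (Fin N) ℂ))}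

variable {N Jw}

/-- Membership in the source. [cite: Weyl1939, Ch. II §10] -/
theorem mem_cayleySourceC_iff (X : skewC N Jw) :
    X ∈ cayleySourceC N Jw ↔ IsUnit (1 + (X : Matrix (Fin N) (Fin N) ℂ)) ∧ IsUnit (1 - (X : Matrix (Fin N) (Fin N) ℂ)) := Iff.rfl

/-- `0` lies in the source. [cite: Weyl1939, Ch. II §10] -/
theorem zero_mem_cayleySourceC : (0 : skewC N Jw) ∈ cayleySourceC N Jw := by
  simp [mem_cayleySourceC_iff]

/-- The source is open. [cite: Knapp2002, I §1] -/
theorem isOpen_cayleySourceC : IsOpen (cayleySourceC N Jw) :=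
  ((isOpen_setOf_isUnit_one_add (R := Matrix (Fin N) (Fin N) ℂ)).preimage continuous_subtype_val).inter
    ((isOpen_setOf_isUnit_one_sub (R := Matrix (Fin N) (Fin N) ℂ)).preimage continuous_subtype_val)

variable (N Jw)

/-- **The Cayley chart `ĉ : 𝔲(Jw) → U(Jw)(ℂ)`**, `X ↦ (1 − X)(1 + X)⁻¹` on the source, junk `1` off it (the one-place reading of ★ `cayleyChart`). [cite: Weyl1939, Ch. II §10] -/
def cayleyChartC (X : skewC N Jw) : unitaryGroupOfForm (starRingEnd ℂ) Jw :=
  if h : X ∈ cayleySourceC N Jw then ⟨(isUnit_cayley h.1 h.2).unit, cayley_mem_unitaryGroupOfForm_conj X.2 h.1 h.2⟩ else 1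

variable {N Jw}

/-- On the source, the chart IS the Cayley transform. [cite: Weyl1939, Ch. II §10] -/
theorem coe_cayleyChartC {X : skewC N Jw} (h : X ∈ cayleySourceC N Jw) :
    (((cayleyChartC N Jw X : unitaryGroupOfForm (starRingEnd ℂ) Jw) : GL (Fin N) ℂ) : Matrix (Fin N) (Fin N) ℂ) =
      cayley (X : Matrix (Fin N) (Fin N) ℂ) := by
  rw [cayleyChartC, dif_pos h]
  exact IsUnit.unit_spec _

/-- Off the source the chart is `1` (junk value). [cite: Weyl1939, Ch. II §10] -/
theorem cayleyChartC_of_not_mem {X : skewC N Jw} (h : X ∉ cayleySourceC N Jw) : cayleyChartC N Jw X = 1 := by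
  rw [cayleyChartC, dif_neg h]

/-- `ĉ 0 = 1`. [cite: Weyl1939, Ch. II §10] -/
theorem cayleyChartC_zero : cayleyChartC N Jw 0 = 1 := by
  apply Subtype.ext; apply Units.ext
  rw [coe_cayleyChartC zero_mem_cayleySourceC]
  simp [cayley_def]

/-- The chart is injective on its source (`ĉ ∘ ĉ = id` there). [cite: Weyl1939, Ch. II §10] -/
theorem injOn_cayleyChartC : Set.InjOn (cayleyChartC N Jw) (cayleySourceC N Jw) := by
  intro X hX Y hY hXY
  have h := congrArg (fun g : unitaryGroupOfForm (starRingEnd ℂ) Jw => cayley (((g : GL (Fin N) ℂ)) : Matrix (Fin N) (Fin N) ℂ)) hXY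
  simp only [coe_cayleyChartC hX, coe_cayleyChartC hY, cayley_cayley hX.1, cayley_cayley hY.1] at h
  exact Subtype.ext h

/-- Continuity into `U(Jw)(ℂ) ≤ GL_N(ℂ)` is read on matrices (`Units.val` is an open embedding). [cite: Knapp2002, I §1] -/
theorem continuousAt_unitary_iff {α : Type*} [TopologicalSpace α] (f : α → unitaryGroupOfForm (starRingEnd ℂ) Jw) (x : α) :
    ContinuousAt f x ↔ ContinuousAt (fun y => (((f y : unitaryGroupOfForm (starRingEnd ℂ) Jw) : GL (Fin N) ℂ) : Matrix (Fin N) (Fin N) ℂ)) x := by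
  have hind : Topology.IsInducing (fun g : unitaryGroupOfForm (starRingEnd ℂ) Jw => ((g : GL (Fin N) ℂ) : Matrix (Fin N) (Fin N) ℂ)) :=
    (Units.isOpenEmbedding_val (R := Matrix (Fin N) (Fin N) ℂ)).isInducing.comp Topology.IsInducing.subtypeVal
  exact hind.continuousAt_iff

/-- The chart is continuous at every point of its source. [cite: Weyl1939, Ch. II §10] -/
theorem continuousAt_cayleyChartC {X : skewC N Jw} (h : X ∈ cayleySourceC N Jw) : ContinuousAt (cayleyChartC N Jw) X := by
  rw [continuousAt_unitary_iff]
  have hev : (fun Y : skewC N Jw => (((cayleyChartC N Jw Y : unitaryGroupOfForm (starRingEnd ℂ) Jw) : GL (Fin N) ℂ) : Matrix (Fin N) (Fin N) ℂ)) =ᶠ[𝓝 X]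
      fun Y => cayley (Y : Matrix (Fin N) (Fin N) ℂ) := by
    filter_upwards [isOpen_cayleySourceC.mem_nhds h] with Y hY
    exact coe_cayleyChartC hY
  refine ContinuousAt.congr_of_eventuallyEq ?_ hev
  exact (continuousAt_cayley h.1).comp continuous_subtype_val.continuousAt

/-- The chart is continuous on its source. [cite: Weyl1939, Ch. II §10] -/
theorem continuousOn_cayleyChartC : ContinuousOn (cayleyChartC N Jw) (cayleySourceC N Jw) :=
  fun _ hX => (continuousAt_cayleyChartC hX).continuousWithinAt

/-- The chart is measurable (continuous on the open source, constant off it). [cite: Helgason2000, Ch. I §1 Thm. 1.14 p. 96] -/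
theorem measurable_cayleyChartC [MeasurableSpace (skewC N Jw)] [BorelSpace (skewC N Jw)]
    [MeasurableSpace (unitaryGroupOfForm (starRingEnd ℂ) Jw)] [BorelSpace (unitaryGroupOfForm (starRingEnd ℂ) Jw)] :
    Measurable (cayleyChartC N Jw) := by
  have e : cayleyChartC N Jw = (cayleySourceC N Jw).piecewise (cayleyChartC N Jw) (fun _ => 1) := by
    funext X
    by_cases hX : X ∈ cayleySourceC N Jw
    · rw [Set.piecewise_eq_of_mem _ _ _ hX]
    · rw [Set.piecewise_eq_of_notMem _ _ _ hX, cayleyChartC_of_not_mem hX]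
  rw [e]
  exact continuousOn_cayleyChartC.measurable_piecewise continuousOn_const isOpen_cayleySourceC.measurableSet

variable (N Jw)

/-- The INVERSE chart `U(Jw)(ℂ) → 𝔲(Jw)`: `g ↦ ĉ(g)` when `1 + g` is invertible (junk `0` off that set). [cite: Weyl1939, Ch. II §10] -/
def cayleyInvC (g : unitaryGroupOfForm (starRingEnd ℂ) Jw) : skewC N Jw :=
  if h : IsUnit (1 + (((g : GL (Fin N) ℂ)) : Matrix (Fin N) (Fin N) ℂ)) then ⟨cayley (((g : GL (Fin N) ℂ)) : Matrix (Fin N) (Fin N) ℂ), cayley_coe_mem_skewC g.2 h⟩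
  else 0

variable {N Jw}

/-- On `{1 + g invertible}` the inverse chart is the Cayley transform. [cite: Weyl1939, Ch. II §10] -/
theorem coe_cayleyInvC {g : unitaryGroupOfForm (starRingEnd ℂ) Jw} (h : IsUnit (1 + (((g : GL (Fin N) ℂ)) : Matrix (Fin N) (Fin N) ℂ))) :
    ((cayleyInvC N Jw g : skewC N Jw) : Matrix (Fin N) (Fin N) ℂ) = cayley (((g : GL (Fin N) ℂ)) : Matrix (Fin N) (Fin N) ℂ) := by
  rw [cayleyInvC, dif_pos h]

/-- `ĉ⁻¹ (ĉ X) = X` on the source. [cite: Weyl1939, Ch. II §10] -/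
theorem cayleyInvC_cayleyChartC {X : skewC N Jw} (h : X ∈ cayleySourceC N Jw) : cayleyInvC N Jw (cayleyChartC N Jw X) = X := by
  have h1 : IsUnit (1 + (((cayleyChartC N Jw X : unitaryGroupOfForm (starRingEnd ℂ) Jw) : GL (Fin N) ℂ) : Matrix (Fin N) (Fin N) ℂ)) := by
    rw [coe_cayleyChartC h]; exact isUnit_one_add_cayley h.1
  apply Subtype.ext
  rw [coe_cayleyInvC h1, coe_cayleyChartC h, cayley_cayley h.1]

/-- `ĉ (ĉ⁻¹ g) = g` when `1 + g` is invertible. [cite: Weyl1939, Ch. II §10] -/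
theorem cayleyChartC_cayleyInvC {g : unitaryGroupOfForm (starRingEnd ℂ) Jw} (h : IsUnit (1 + (((g : GL (Fin N) ℂ)) : Matrix (Fin N) (Fin N) ℂ))) :
    cayleyChartC N Jw (cayleyInvC N Jw g) = g := by
  have hs : cayleyInvC N Jw g ∈ cayleySourceC N Jw := by
    rw [mem_cayleySourceC_iff, coe_cayleyInvC h]
    exact ⟨isUnit_one_add_cayley h, (isUnit_one_sub_cayley_iff h).2 (g : GL (Fin N) ℂ).isUnit⟩
  apply Subtype.ext; apply Units.ext
  rw [coe_cayleyChartC hs, coe_cayleyInvC h, cayley_cayley h]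

/-- The inverse chart is continuous on the open set `{1 + g invertible}`. [cite: Weyl1939, Ch. II §10] -/
theorem continuousOn_cayleyInvC :
    ContinuousOn (cayleyInvC N Jw) {g : unitaryGroupOfForm (starRingEnd ℂ) Jw | IsUnit (1 + (((g : GL (Fin N) ℂ)) : Matrix (Fin N) (Fin N) ℂ))} := by
  intro g hg
  have hT : IsOpen {g : unitaryGroupOfForm (starRingEnd ℂ) Jw | IsUnit (1 + (((g : GL (Fin N) ℂ)) : Matrix (Fin N) (Fin N) ℂ))} :=
    (isOpen_setOf_isUnit_one_add (R := Matrix (Fin N) (Fin N) ℂ)).preimage (Units.continuous_val.comp continuous_subtype_val)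
  refine (Topology.IsInducing.subtypeVal.continuousAt_iff.2 ?_).continuousWithinAt
  have hev : (fun g' : unitaryGroupOfForm (starRingEnd ℂ) Jw => ((cayleyInvC N Jw g' : skewC N Jw) : Matrix (Fin N) (Fin N) ℂ)) =ᶠ[𝓝 g]
      fun g' => cayley (((g' : GL (Fin N) ℂ)) : Matrix (Fin N) (Fin N) ℂ) := by
    filter_upwards [hT.mem_nhds hg] with g' hg'
    exact coe_cayleyInvC hg'
  refine ContinuousAt.congr_of_eventuallyEq ?_ hev
  have hc : Continuous fun g' : unitaryGroupOfForm (starRingEnd ℂ) Jw => (((g' : GL (Fin N) ℂ)) : Matrix (Fin N) (Fin N) ℂ) :=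
    Units.continuous_val.comp continuous_subtype_val
  have hcomp : ContinuousAt (cayley ∘ fun g' : unitaryGroupOfForm (starRingEnd ℂ) Jw => (((g' : GL (Fin N) ℂ)) : Matrix (Fin N) (Fin N) ℂ)) g :=
    ContinuousAt.comp (hg := continuousAt_cayley hg) (hf := hc.continuousAt)
  exact hcomp

/-- The image of a subset `S` of the source: `ĉ '' S = {1 + g invertible} ∩ (ĉ⁻¹)⁻¹' S`. [cite: Weyl1939, Ch. II §10] -/
theorem image_cayleyChartC_eq {S : Set (skewC N Jw)} (hS : S ⊆ cayleySourceC N Jw) :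
    cayleyChartC N Jw '' S =
      {g : unitaryGroupOfForm (starRingEnd ℂ) Jw | IsUnit (1 + (((g : GL (Fin N) ℂ)) : Matrix (Fin N) (Fin N) ℂ))} ∩ cayleyInvC N Jw ⁻¹' S := by
  ext g
  constructor
  · rintro ⟨X, hX, rfl⟩
    refine ⟨?_, ?_⟩
    · show IsUnit (1 + _)
      rw [coe_cayleyChartC (hS hX)]; exact isUnit_one_add_cayley (hS hX).1
    · show cayleyInvC N Jw (cayleyChartC N Jw X) ∈ S
      rw [cayleyInvC_cayleyChartC (hS hX)]; exact hX
  · rintro ⟨hg, hgS⟩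
    exact ⟨cayleyInvC N Jw g, hgS, cayleyChartC_cayleyInvC hg⟩

/-- Images of open subsets of the source are open (the inverse chart is explicit and continuous). [cite: Weyl1939, Ch. II §10] -/
theorem isOpen_image_cayleyChartC {S : Set (skewC N Jw)} (hS : S ⊆ cayleySourceC N Jw) (hSo : IsOpen S) : IsOpen (cayleyChartC N Jw '' S) := by
  rw [image_cayleyChartC_eq hS]
  exact continuousOn_cayleyInvC.isOpen_inter_preimage
    ((isOpen_setOf_isUnit_one_add (R := Matrix (Fin N) (Fin N) ℂ)).preimage (Units.continuous_val.comp continuous_subtype_val)) hSo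

end Skew

end UnitaryArchLocalTopForm

end Literature.NumberTheory.Weil1964

end
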